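import Mathlib
import Summits.AnomalousDissipation.AnomalousDissipation.Theorems.MarginalStabilityChainStretchedVortexRowsStubRowVorticityConstructionToolsPoisson
import Summits.AnomalousDissipation.AnomalousDissipation.Theorems.MarginalStabilityChainStretchedVortexRowsStubRowVorticityConstructionToolsDecayB
import Summits.AnomalousDissipation.AnomalousDissipation.Theorems.MarginalStabilityChainStretchedVortexRowsStubRowVorticityConstructionToolsSymm
import Summits.AnomalousDissipation.AnomalousDissipation.Theorems.MarginalStabilityChainStretchedVortexRowsStubRowVorticityConstructionToolsFarU

/-!
# Stub `stub_rowVorticityConstruction` (crux stmt-AnomalousDissipation-3009) — tools XVII: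
# THE CYLINDER BIOT–SAVART LAW (capstone) and the reduction of the stub to the construction of the vorticity

Helper file (supports stmt-AnomalousDissipation-3009). Assembles tools I–XVI into

* **`rowBiotSavart_law`** — for `L > 0` and a plane field `ω ∈ C³`, `L`-periodic in `x`, point-symmetric
  (`ω(−x,−y) = ω(x,y)`), with Gaussian bounds on `D^i ω` (`i ≤ 3`) and CIRCULATION `−L` PER PERIOD
  (`∫_{S_L} ω = −L`), the cylinder Biot–Savart velocity
  `u = −(2L)⁻¹∫_{S_L}K₁ω(· − q)`, `v = (2L)⁻¹∫_{S_L}K₂ω(· − q)` is `C³`, `L`-periodic, point-antisymmetric,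
  divergence free, has curl `ω`, the shear far field `u → ±1/2`, `v → 0` (`y → ±∞`, every `x`) and the exponential
  decay package `|∂ₓu| + |∂_yu| + |∂ₓv| + |∂_yv| + |∂_y²u| ≤ C′e^{−(π/L)|y|}`;
* **`rowVelocity_of_vorticity`** — THE REDUCTION: if moreover `ω` solves the steady stretched VORTICITY EQUATION
  `u ωₓ + (v − y) ω_y = ω + νΔω` with this `(u, v)` and `|(ν/L)∫_{(0,L]}∫ ω² − L/(8π)| ≤ Cν`, then the whole
  nine-clause `∃ u v` conclusion of `stub_rowVorticityConstruction` holds at `(L, C, ν)`: the stub is thereby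
  reduced to the CONSTRUCTION OF SUCH AN `ω` (the two-region implicit-function theorem on
  `h₁ = CellSolvability`, `h₂ = CoreInverseUniform`, `h₃ = BraidExit`).
Registered sub-goal proved here: `stub_rowVorticityConstruction_ofVorticity`. All `[folklore]`.
-/

set_option linter.dupNamespace false

noncomputable section

open Real Set Filter Topology MeasureTheory
open Literature.Analysis.FluidPDE Literature.Analysis.FluidPDE.StretchedLayer

namespace Summit.AnomalousDissipation.AnomalousDissipation.Theorems.MarginalStabilityChainStretchedVortexRows.RowBiotSavart

section Law

variable {L : ℝ} {ω : ℝ → ℝ → ℝ}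

/-- **The cylinder Biot–Savart law** (capstone of tools I–XVI). [folklore] -/
theorem rowBiotSavart_law (hL : 0 < L) (hω : ContDiff ℝ 3 fun p : ℝ × ℝ => ω p.1 p.2)
    (hB : ∀ i ≤ 3, ∃ C a : ℝ, 0 < a ∧
      ∀ p, ‖iteratedFDeriv ℝ i (fun p : ℝ × ℝ => ω p.1 p.2) p‖ ≤ C * Real.exp (-a * p.2 ^ 2))
    (hper : ∀ x y, ω (x + L) y = ω x y) (hsym : ∀ x y, ω (-x) (-y) = ω x y)
    (hM : ∫ q in Ioc (-(L / 2)) (L / 2) ×ˢ (univ : Set ℝ), ω q.1 q.2 = -L) :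
    let u : ℝ → ℝ → ℝ := fun a b => -(1 / (2 * L)) * ∫ q in Ioc (-(L / 2)) (L / 2) ×ˢ (univ : Set ℝ),
      Real.sinh (2 * π * q.2 / L) / (Real.cosh (2 * π * q.2 / L) - Real.cos (2 * π * q.1 / L)) * ω (a - q.1) (b - q.2)
    let v : ℝ → ℝ → ℝ := fun a b => 1 / (2 * L) * ∫ q in Ioc (-(L / 2)) (L / 2) ×ˢ (univ : Set ℝ),
      Real.sin (2 * π * q.1 / L) / (Real.cosh (2 * π * q.2 / L) - Real.cos (2 * π * q.1 / L)) * ω (a - q.1) (b - q.2)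
    ContDiff ℝ 3 (fun q : ℝ × ℝ => u q.1 q.2) ∧ ContDiff ℝ 3 (fun q : ℝ × ℝ => v q.1 q.2) ∧
      (∀ x y, u (x + L) y = u x y ∧ v (x + L) y = v x y) ∧ (∀ x y, u (-x) (-y) = -u x y ∧ v (-x) (-y) = -v x y) ∧
      (∀ x y, dX u x y + dY v x y = 0) ∧ (∀ x y, dX v x y - dY u x y = ω x y) ∧
      (∀ x, Tendsto (fun y => u x y) atTop (𝓝 (1 / 2)) ∧ Tendsto (fun y => u x y) atBot (𝓝 (-(1 / 2))) ∧
        Tendsto (fun y => v x y) atTop (𝓝 0) ∧ Tendsto (fun y => v x y) atBot (𝓝 0)) ∧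
      (∃ C' c : ℝ, 0 < c ∧ ∀ x y,
        |dX u x y| + |dY u x y| + |dX v x y| + |dY v x y| + |dY (dY u) x y| ≤ C' * Real.exp (-c * |y|)) := by
  intro u v
  have hω2 : ContDiff ℝ 2 fun p : ℝ × ℝ => ω p.1 p.2 := hω.of_le (by norm_num)
  have hB2 : ∀ i ≤ 2, ∃ C a : ℝ, 0 < a ∧
      ∀ p, ‖iteratedFDeriv ℝ i (fun p : ℝ × ℝ => ω p.1 p.2) p‖ ≤ C * Real.exp (-a * p.2 ^ 2) :=
    fun i hi => hB i (hi.trans (by norm_num))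
  obtain ⟨⟨C, a, ha, hb⟩, -⟩ := gaussBounds_of_iterated (ω := ω) fun i hi => hB i (hi.trans (by norm_num))
  refine ⟨contDiff_rowBS_u hL hω hB, contDiff_rowBS_v hL hω hB, fun x y => ⟨?_, ?_⟩, fun x y => ⟨?_, ?_⟩,
    fun x y => divFree_rowBS hL hω2 hB2 hper x y, fun x y => curl_rowBS hL hω2 hB2 hper x y, fun x => ?_, ?_⟩
  · show -(1 / (2 * L)) * _ = -(1 / (2 * L)) * _
    rw [rowConv_add_period _ hper]
  · show 1 / (2 * L) * _ = 1 / (2 * L) * _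
    rw [rowConv_add_period _ hper]
  · show -(1 / (2 * L)) * _ = -(-(1 / (2 * L)) * _)
    rw [rowConv_neg_neg_of_odd (fun q => rowKerU_neg L q) hsym, mul_neg]
  · show 1 / (2 * L) * _ = -(1 / (2 * L) * _)
    rw [rowConv_neg_neg_of_odd (fun q => rowKerV_neg L q) hsym, mul_neg]
  · obtain ⟨h1, h2, h3, h4⟩ := stub_rowVorticityConstruction_biotSavartFarField L ω C a hL ha hω.continuous hb hper x
    rw [hM] at h1 h2
    have e1 : -(1 / (2 * L)) * -L = 1 / 2 := by field_simp
    have e2 : 1 / (2 * L) * -L = -(1 / 2) := by field_simp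
    rw [e1] at h1; rw [e2] at h2
    exact ⟨h1, h2, h3, h4⟩
  · obtain ⟨C₀, hC₀⟩ := decay_rowBS hL hω2 hB2 hper
    exact ⟨C₀, π / L, by positivity, hC₀⟩

/-- **The reduction of `stub_rowVorticityConstruction` to the construction of the vorticity.** [folklore] -/
theorem rowVelocity_of_vorticity (hL : 0 < L) {ν C₁ : ℝ} (hω : ContDiff ℝ 3 fun p : ℝ × ℝ => ω p.1 p.2)
    (hB : ∀ i ≤ 3, ∃ C a : ℝ, 0 < a ∧
      ∀ p, ‖iteratedFDeriv ℝ i (fun p : ℝ × ℝ => ω p.1 p.2) p‖ ≤ C * Real.exp (-a * p.2 ^ 2))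
    (hper : ∀ x y, ω (x + L) y = ω x y) (hsym : ∀ x y, ω (-x) (-y) = ω x y)
    (hM : ∫ q in Ioc (-(L / 2)) (L / 2) ×ˢ (univ : Set ℝ), ω q.1 q.2 = -L)
    (hvort : ∀ x y,
      (-(1 / (2 * L)) * ∫ q in Ioc (-(L / 2)) (L / 2) ×ˢ (univ : Set ℝ),
        Real.sinh (2 * π * q.2 / L) / (Real.cosh (2 * π * q.2 / L) - Real.cos (2 * π * q.1 / L)) *
          ω (x - q.1) (y - q.2)) * dX ω x y +
      ((1 / (2 * L) * ∫ q in Ioc (-(L / 2)) (L / 2) ×ˢ (univ : Set ℝ),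
        Real.sin (2 * π * q.1 / L) / (Real.cosh (2 * π * q.2 / L) - Real.cos (2 * π * q.1 / L)) *
          ω (x - q.1) (y - q.2)) - y) * dY ω x y = ω x y + ν * lap ω x y)
    (hens : |(ν / L * ∫ x in Ioc 0 L, ∫ y, ω x y ^ 2) - L / (8 * π)| ≤ C₁ * ν) :
    ∃ u v : ℝ → ℝ → ℝ,
      ContDiff ℝ 3 (fun q : ℝ × ℝ => u q.1 q.2) ∧ ContDiff ℝ 3 (fun q : ℝ × ℝ => v q.1 q.2) ∧
      (∀ x y, u (x + L) y = u x y ∧ v (x + L) y = v x y) ∧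
      (∀ x y, u (-x) (-y) = -u x y ∧ v (-x) (-y) = -v x y) ∧
      (∀ x y, dX u x y + dY v x y = 0) ∧
      (∀ x y, u x y * dX (fun a b => dX v a b - dY u a b) x y +
          (v x y - y) * dY (fun a b => dX v a b - dY u a b) x y =
        (dX v x y - dY u x y) + ν * lap (fun a b => dX v a b - dY u a b) x y) ∧
      (∀ x, Tendsto (fun y => u x y) atTop (𝓝 (1 / 2)) ∧ Tendsto (fun y => u x y) atBot (𝓝 (-(1 / 2))) ∧
        Tendsto (fun y => v x y) atTop (𝓝 0) ∧ Tendsto (fun y => v x y) atBot (𝓝 0)) ∧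
      (∃ C' a : ℝ, 0 < a ∧ ∀ x y, |dX v x y - dY u x y| ≤ C' * Real.exp (-a * y ^ 2)) ∧
      (∃ C' a : ℝ, 0 < a ∧ ∀ x y,
        |dX u x y| + |dY u x y| + |dX v x y| + |dY v x y| + |dY (dY u) x y| ≤ C' * Real.exp (-a * |y|)) ∧
      |(ν / L * ∫ x in Ioc 0 L, ∫ y, (dX v x y - dY u x y) ^ 2) - L / (8 * π)| ≤ C₁ * ν := by
  obtain ⟨hu3, hv3, hP, hS, hdiv, hcurl, hfar, hdec⟩ := rowBiotSavart_law hL hω hB hper hsym hM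
  obtain ⟨⟨C, a, ha, hb⟩, -⟩ := gaussBounds_of_iterated (ω := ω) fun i hi => hB i (hi.trans (by norm_num))
  refine ⟨_, _, hu3, hv3, hP, hS, hdiv, ?_, hfar, ⟨C, a, ha, fun x y => by rw [hcurl]; exact hb x y⟩, hdec, ?_⟩
  · have hω' : (fun a b => dX (fun a b => 1 / (2 * L) * ∫ q in Ioc (-(L / 2)) (L / 2) ×ˢ (univ : Set ℝ),
        Real.sin (2 * π * q.1 / L) / (Real.cosh (2 * π * q.2 / L) - Real.cos (2 * π * q.1 / L)) * ω (a - q.1) (b - q.2))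
        a b - dY (fun a b => -(1 / (2 * L)) * ∫ q in Ioc (-(L / 2)) (L / 2) ×ˢ (univ : Set ℝ),
        Real.sinh (2 * π * q.2 / L) / (Real.cosh (2 * π * q.2 / L) - Real.cos (2 * π * q.1 / L)) * ω (a - q.1) (b - q.2))
        a b) = ω := funext fun a => funext fun b => hcurl a b
    intro x y
    rw [hω', hcurl]
    exact hvort x y
  · have hω' : ∀ x y, (dX (fun a b => 1 / (2 * L) * ∫ q in Ioc (-(L / 2)) (L / 2) ×ˢ (univ : Set ℝ),
        Real.sin (2 * π * q.1 / L) / (Real.cosh (2 * π * q.2 / L) - Real.cos (2 * π * q.1 / L)) * ω (a - q.1) (b - q.2))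
        x y - dY (fun a b => -(1 / (2 * L)) * ∫ q in Ioc (-(L / 2)) (L / 2) ×ˢ (univ : Set ℝ),
        Real.sinh (2 * π * q.2 / L) / (Real.cosh (2 * π * q.2 / L) - Real.cos (2 * π * q.1 / L)) * ω (a - q.1) (b - q.2))
        x y) ^ 2 = ω x y ^ 2 := fun x y => by rw [hcurl]
    simp_rw [hω']
    exact hens

end Law

end RowBiotSavart

open RowBiotSavart in
/-- **Reduction of `stub_rowVorticityConstruction` to the construction of the vorticity** (registered on
stmt-AnomalousDissipation-3009 as the helper stub `stub_rowVorticityConstruction_ofVorticity`): for `L > 0`, `ν`, `C`,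
every plane field `ω ∈ C³`, `L`-periodic in `x`, point-symmetric, with Gaussian bounds on `D^iω` (`i ≤ 3`), circulation
`−L` per period, solving the steady stretched vorticity equation `u ωₓ + (v − y) ω_y = ω + νΔω` with ITS OWN cylinder
Biot–Savart velocity `(u, v)` and with `|(ν/L)∫_{(0,L]}∫ω² − L/(8π)| ≤ Cν`, yields the nine-clause `∃ u v` conclusion of
the stub at `(L, C, ν)` (`RowBiotSavart.rowVelocity_of_vorticity`: the cylinder Biot–Savart law, tools I–XVII). What
remains of the stub is the construction of such an `ω` from `h₁, h₂, h₃` (the two-region implicit-function theorem).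
[folklore] -/
theorem stub_rowVorticityConstruction_ofVorticity :
    ∀ (L ν C : ℝ) (ω : ℝ → ℝ → ℝ), 0 < L → ContDiff ℝ 3 (fun p : ℝ × ℝ => ω p.1 p.2) →
      (∀ i ≤ 3, ∃ C a : ℝ, 0 < a ∧
        ∀ p : ℝ × ℝ, ‖iteratedFDeriv ℝ i (fun p : ℝ × ℝ => ω p.1 p.2) p‖ ≤ C * Real.exp (-a * p.2 ^ 2)) →
      (∀ x y, ω (x + L) y = ω x y) → (∀ x y, ω (-x) (-y) = ω x y) →
      (∫ q in Set.Ioc (-(L / 2)) (L / 2) ×ˢ (Set.univ : Set ℝ), ω q.1 q.2 = -L) →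
      (∀ x y,
        (-(1 / (2 * L)) * ∫ q in Set.Ioc (-(L / 2)) (L / 2) ×ˢ (Set.univ : Set ℝ),
          Real.sinh (2 * Real.pi * q.2 / L) / (Real.cosh (2 * Real.pi * q.2 / L) - Real.cos (2 * Real.pi * q.1 / L)) *
            ω (x - q.1) (y - q.2)) * dX ω x y +
        ((1 / (2 * L) * ∫ q in Set.Ioc (-(L / 2)) (L / 2) ×ˢ (Set.univ : Set ℝ),
          Real.sin (2 * Real.pi * q.1 / L) / (Real.cosh (2 * Real.pi * q.2 / L) - Real.cos (2 * Real.pi * q.1 / L)) *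
            ω (x - q.1) (y - q.2)) - y) * dY ω x y = ω x y + ν * lap ω x y) →
      |(ν / L * ∫ x in Set.Ioc 0 L, ∫ y, ω x y ^ 2) - L / (8 * Real.pi)| ≤ C * ν →
      ∃ u v : ℝ → ℝ → ℝ,
        ContDiff ℝ 3 (fun q : ℝ × ℝ => u q.1 q.2) ∧ ContDiff ℝ 3 (fun q : ℝ × ℝ => v q.1 q.2) ∧
        (∀ x y, u (x + L) y = u x y ∧ v (x + L) y = v x y) ∧
        (∀ x y, u (-x) (-y) = -u x y ∧ v (-x) (-y) = -v x y) ∧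
        (∀ x y, dX u x y + dY v x y = 0) ∧
        (∀ x y, u x y * dX (fun a b => dX v a b - dY u a b) x y +
            (v x y - y) * dY (fun a b => dX v a b - dY u a b) x y =
          (dX v x y - dY u x y) + ν * lap (fun a b => dX v a b - dY u a b) x y) ∧
        (∀ x, Filter.Tendsto (fun y => u x y) Filter.atTop (nhds (1 / 2)) ∧
          Filter.Tendsto (fun y => u x y) Filter.atBot (nhds (-(1 / 2))) ∧
          Filter.Tendsto (fun y => v x y) Filter.atTop (nhds 0) ∧ Filter.Tendsto (fun y => v x y) Filter.atBot (nhds 0)) ∧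
        (∃ C' a : ℝ, 0 < a ∧ ∀ x y, |dX v x y - dY u x y| ≤ C' * Real.exp (-a * y ^ 2)) ∧
        (∃ C' a : ℝ, 0 < a ∧ ∀ x y,
          |dX u x y| + |dY u x y| + |dX v x y| + |dY v x y| + |dY (dY u) x y| ≤ C' * Real.exp (-a * |y|)) ∧
        |(ν / L * ∫ x in Set.Ioc 0 L, ∫ y, (dX v x y - dY u x y) ^ 2) - L / (8 * Real.pi)| ≤ C * ν :=
  fun _ _ _ _ hL hω hB hper hsym hM hvort hens => rowVelocity_of_vorticity hL hω hB hper hsym hM hvort hens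

end Summit.AnomalousDissipation.AnomalousDissipation.Theorems.MarginalStabilityChainStretchedVortexRows

end
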